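import Summits.CriticalPhenomena.PercolationContinuityZ3.Theorems.PercNearOneGluingNoHeavyQuantFarTreeRowOfTreeBuilt
import Summits.CriticalPhenomena.PercolationContinuityZ3.Theorems.PercNearOneGluingNoHeavyQuantTreeDECOfSDEC
import Summits.CriticalPhenomena.PercolationContinuityZ3.Theorems.PercNearOneGluingNoHeavyQuantGatedConvReduction
import Summits.CriticalPhenomena.PercolationContinuityZ3.Theorems.PercNearOneGluingNoHeavyQuantGateMove
import HarnessLib

/-!
# QUANT lane R8, T-DEC: THE SINGLE-GATE CONVOLUTION CLOSURE — one law-level statement that carries BOTH legs (II) and (III)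
# of the R8-on-trees architecture with ONE gate in hypotheses and conclusion; `SingleGateConvClosed ⟹ SDECConvClosed ⟹
# TreeBuiltDEC, GateMove, GatedConvEmptyFree, TreeDEC, FarTreeRow` (kernel, five short reductions)

builds on p205010 (kernel theorem, internal audit signed; external expert review pending)

Statement + support file (`--supports stmt-CriticalPhenomena-4575`), QUANT lane lead seat prim-quant-lead (gen 28), rung R8 of
`run/shared/lean/prim/quant/LADDER.md`.  One `@[conjecture]` (`LawDec.SingleGateConvClosed`), theorems with standard axioms, no sorries.
Continues census-2 g53's `…QuantSDEC` (`gate`, `lconv`, `SDEC`, `@[conjecture] SDECConvClosed`), typer g25's `…QuantGatedConvReduction`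
(`SDECUpTo`, `@[conjecture] GatedConvEmptyFree`), typer g26's `…QuantGateMove`, and lead g20's bridge `…QuantFarTreeRowOfTreeBuilt`.

THE STATEMENT (lead g28, LEAD-NOTES-G28 N80–N83).  For a floor `0 < y < 1`, ONE gate `0 < q ≤ 1`, and probability laws `μ₁` on `{0..M₁}`,
`μ₂` on `{0..M₂}` (nonnegative, vanishing above the top, mass `1`; ANY zero atoms) whose GATED versions `gate_q μᵢ = (1−q)δ₀ + q·μᵢ` are
top-affordable at `y` (`y·Mᵢ ≤ q·mean μᵢ`) and DEC at EVERY layer `j′ < Mᵢ` at floor `y`:  the gated convolution `gate_q(μ₁ ∗ μ₂)` is DEC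
at every layer `j′ < M₁ + M₂` at floor `y`.  In tree language: two subtrees hung under a COMMON parent edge are DEC as soon as each subtree
hung alone under that edge is DEC.  `q = 1` is census-2 g53's observation that DEC-at-all-layers is closed under plain convolution (the
all-layer form of leg (II)); `q < 1` is the gate interaction (leg (III)) with the SAME gate in the hypotheses — no family of smaller gates
(`SDECUpTo`), no `posPart`/`coPart`.  Census-2 g53's counterexamples to "DEC is gate-closed" (kit j130794) gate a BARE law; here the gate is
already inside the hypotheses, which is why the statement can hold.

WHY ONE GATE IS ENOUGH (the evidence, exact rational LPs, lead g28 `explore/exp7*.py`–`exp10*.py`, kit j164722/j164723 attached to 4575).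
Write `ν := gate_q μ₁` (zero atom `p = ν 0`).  Then `gate_q(μ₁ ∗ μ₂) = (p′/a′)·lconv(gate_q μ₁, gate_q μ₂) + … ·pconv(ν, μ₂⋆)` (typer g25's
`gate_lconv_split`), where `pconv(ν, G) := ν(0)δ₀ + Σ_{k ≥ 1} ν(k)·G(· − k)` convolves `G` into the POSITIVE part of `ν` only and
`gate_{1 − ν 0}(μ₂⋆) = gate_q μ₂`; so the statement is EQUIVALENT to the "pconv form" E⋆: `ν` DEC at all layers at `y`, `gate_{1−ν 0} G`
DEC at all layers at `y` ⟹ `pconv(ν, G)` DEC at all layers at `y` (target `mean ν + (1 − ν 0)·mean G`).  Boundary-pushed censuses (the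
floor `y` bisected to the edge of the all-layer hypothesis of each factor, so that the hypotheses bind): E⋆ general `G`: 800 pairs /
4 473 layer instances / 0 failures (307 of them with `G` itself NOT DEC at floor `y/(1−ν 0)`, so the weaker one-gate hypothesis is really
used); blob `G = {0, a; g}` (= PM, the blob hung under a relay vertex; hypothesis `gate_{1−p} G` DEC ⟺ `g(1−p) ≥ y`): 32 880 / 0 with
`g(1−p) ≥ y` versus 4 384 failures / 27 336 just below that threshold (the threshold is sharp: `ν = gate_q δ_M` at a layer `M ≤ j < M+a`);
arbitrary empty-free `μ₁` with the hypothesis at ALL layers: 4 795 / 0, while top-affordability alone fails 324 / 254 972 and the single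
hypothesis layer `min(j, M)` fails 83 times (all at `j ≥ M₁`: the top layers of the conclusion need the hypothesis at layer `M₁ − 1`);
kit j164722 ✓ (E⋆, BOTH factors boundary-pushed, `M₁ ≤ 6`, `M₂ ≤ 5`): 6 400 pairs / 41 402 layer instances / 0 failures (2 117 with `G` not DEC at
the scaled floor, 8 401 at `p = 0`); kit j164723 ✓ (blob case, `M ≤ 7`, `a ≤ 4`, 40 000 boundary-pushed laws): hypothesis on the layer WINDOW `[j−a, min(j, M₁−1)]`
160 000 / 0 (the single layer `min(j, M₁−1)` alone fails 2 / 160 000 — pure shifts; the window is the shape of `SliceClosedWindowT`); typer g25's single-gate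
census `gc2.py` 0 / 754.  SPECIAL CASES ALREADY KERNEL: `μ₁ = δ_k`
(Conjecture R, typer g26 `gatedShiftDEC_holds`), the blob beside a law whose zero atom dominates (lead g27 `sdec_slice_of_dominated`),
`q = 1` with a blob factor (the slice theorem `sliceClosedWindowT_holds`), spines / blob-spines.

CONSEQUENCES (this file, kernel): `SingleGateConvClosed ⟹ SDECConvClosed` (apply it at floor `q·x` for each gate `q`: five lines —
the `posPart`/`coPart` reduction of `…QuantGatedConvReduction` is not needed), hence `⟹ TreeBuiltDEC`, `GateMove`, `TreeDEC`, `FarTreeRow`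
(census-2 g53 / lead g20 / typer g26 bridges), and directly `⟹ GatedConvEmptyFree` (leg (III) as typed).  So R8 on trees follows from this
ONE statement; the lane's cell programme for (II) (`LightSliceLowCross ∧ LightSliceWide`) is its `q = 1` slice, and the piece anatomy of
(III) (lead g26/g27, arm-1 g38) is the same cell programme for the pieces `gate_γ(S_h G)` of the zero-components `{0, h; γ}` of `ν`.
HONEST STATUS: `SingleGateConvClosed` is OPEN (a conjecture with exact evidence); everything downstream stays conditional on it; the RATE
class log\* and the honest sentence of `run/shared/lean/prim/quant/README.md` are unchanged.

* `LawDec.SingleGateConvClosed` (`@[conjecture]`).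
* `LawDec.sdecConvClosed_of_singleGate : SingleGateConvClosed → SDECConvClosed`.
* `LawDec.gatedConvEmptyFree_of_singleGate : SingleGateConvClosed → GatedConvEmptyFree`;  `LawDec.gateMove_of_singleGate`.
* `treeBuiltDEC_of_singleGate`, `treeDEC_of_singleGate`, **`farTreeRow_of_singleGate : LawDec.SingleGateConvClosed → FarTreeRow`**.

[this work]; SDEC / `SDECConvClosed`: prim-quant-census-2 g53; `GatedConvEmptyFree`: prim-quant-stmt g25; bridges: prim-quant-lead g20,
prim-quant-stmt g22/g26 (this lane).  Nothing here is cited as a published result.  The gluing rows served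
[cite: KozmaNitzan2024, Conjecture 3 (p. 15)]; product measure [cite: Grimmett1999, §1.3 p. 10].
-/

noncomputable section

namespace Summit.CriticalPhenomena.PercolationContinuityZ3.Theorems

namespace Quant

open Finset

namespace LawDec

/-- **CONJECTURE (SINGLE-GATE CONVOLUTION CLOSURE; lead g28).**  For a floor `0 < y < 1`, one gate `0 < q ≤ 1` and probability laws
`μ₁` on `{0..M₁}`, `μ₂` on `{0..M₂}` (nonnegative, vanishing above the top, mass `1`) whose gated versions are top-affordable at `y`
(`y·Mᵢ ≤ q·Σ h·μᵢ h`, i.e. the floor is affordable for the top of `gate μᵢ q`) and DEC at every layer below the top at floor `y`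
(`DECAt y j′ Mᵢ (gate μᵢ q)` for all `j′ < Mᵢ`), the gated convolution is DEC at every layer below its top at floor `y`:
`DECAt y j′ (M₁ + M₂) (gate (lconv M₁ M₂ μ₁ μ₂) q)` for all `j′ < M₁ + M₂`.  (Layers `≥` the top are Theorem A, `decAt_of_top_le`.)
`q = 1`: DEC at all layers is closed under convolution (leg (II), all-layer form); `q < 1`: the gate interaction (leg (III)) with the same
gate in hypotheses and conclusion.  EVIDENCE: exact boundary-pushed LP censuses, 0 failures (module docstring; kit j164722 / j164723 on
item 4575); the blob threshold `g(1 − ν 0) ≥ y` of its PM instance is sharp.  Implies `SDECConvClosed`, `GatedConvEmptyFree`, `GateMove`,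
`TreeBuiltDEC`, `TreeDEC`, `FarTreeRow` (below).
builds on p205010 (kernel theorem, internal audit signed; external expert review pending). [this work] [status: open] -/
@[conjecture] def SingleGateConvClosed : Prop :=
  ∀ (y q : ℝ) (M₁ M₂ : ℕ) (μ₁ μ₂ : ℕ → ℝ),
    0 < y → y < 1 → 0 < q → q ≤ 1 →
    (∀ h, 0 ≤ μ₁ h) → (∀ h, M₁ < h → μ₁ h = 0) → (∑ h ∈ Finset.range (M₁ + 1), μ₁ h = 1) →
    y * (M₁ : ℝ) ≤ q * ∑ h ∈ Finset.range (M₁ + 1), (h : ℝ) * μ₁ h →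
    (∀ h, 0 ≤ μ₂ h) → (∀ h, M₂ < h → μ₂ h = 0) → (∑ h ∈ Finset.range (M₂ + 1), μ₂ h = 1) →
    y * (M₂ : ℝ) ≤ q * ∑ h ∈ Finset.range (M₂ + 1), (h : ℝ) * μ₂ h →
    (∀ j', j' < M₁ → DECAt y j' M₁ (gate μ₁ q)) →
    (∀ j', j' < M₂ → DECAt y j' M₂ (gate μ₂ q)) →
    ∀ j', j' < M₁ + M₂ → DECAt y j' (M₁ + M₂) (gate (lconv M₁ M₂ μ₁ μ₂) q)

/-- **`SingleGateConvClosed ⟹ SDECConvClosed`**: for SDEC factors at floor `x` and a gate `q`, apply the single-gate closure at floor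
`q·x` — the hypotheses `DECAt (q·x) j′ Mᵢ (gate μᵢ q)` are the gate-`q` instances of `SDEC x Mᵢ μᵢ`, top-affordability scales by `q`.
[this work] -/
theorem sdecConvClosed_of_singleGate (hS : SingleGateConvClosed) : SDECConvClosed := by
  intro x M₁ M₂ μ₁ μ₂ hx0 hx1 h10 h1M h11 hta1 h20 h2M h21 hta2 hS1 hS2 q hq0 hq1 j' hj'
  have hy0 : 0 < q * x := mul_pos hq0 hx0
  have hy1 : q * x < 1 := by nlinarith
  have hta1' : q * x * (M₁ : ℝ) ≤ q * ∑ h ∈ Finset.range (M₁ + 1), (h : ℝ) * μ₁ h := by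
    rw [mul_assoc]; exact mul_le_mul_of_nonneg_left hta1 hq0.le
  have hta2' : q * x * (M₂ : ℝ) ≤ q * ∑ h ∈ Finset.range (M₂ + 1), (h : ℝ) * μ₂ h := by
    rw [mul_assoc]; exact mul_le_mul_of_nonneg_left hta2 hq0.le
  exact hS (q * x) q M₁ M₂ μ₁ μ₂ hy0 hy1 hq0 hq1 h10 h1M h11 hta1' h20 h2M h21 hta2'
    (fun j hj => hS1 q hq0 hq1 j hj) (fun j hj => hS2 q hq0 hq1 j hj) j' hj'

/-- **`SingleGateConvClosed ⟹ GatedConvEmptyFree`** (leg (III) as typed by typer g25): for `q ≤ Q` apply the single-gate closure at floor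
`q·x`; the hypotheses are the gate-`q` instances of `SDECUpTo x Q`.  (The empty-free hypothesis `μ₁ 0 = 0` is not used.) [this work] -/
theorem gatedConvEmptyFree_of_singleGate (hS : SingleGateConvClosed) : GatedConvEmptyFree := by
  intro x Q M₁ M₂ μ₁ μ₂ hx0 _ _ hQ1 hQx h10 h1M h11 hta1 h20 h2M h21 hta2 _ hS1 hS2 q hq0 hqQ j' hj'
  have hq1 : q ≤ 1 := hqQ.trans hQ1
  have hy0 : 0 < q * x := mul_pos hq0 hx0
  have hy1 : q * x < 1 := lt_of_le_of_lt (mul_le_mul_of_nonneg_right hqQ hx0.le) hQx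
  have hta1' : q * x * (M₁ : ℝ) ≤ q * ∑ h ∈ Finset.range (M₁ + 1), (h : ℝ) * μ₁ h := by
    rw [mul_assoc]; exact mul_le_mul_of_nonneg_left hta1 hq0.le
  have hta2' : q * x * (M₂ : ℝ) ≤ q * ∑ h ∈ Finset.range (M₂ + 1), (h : ℝ) * μ₂ h := by
    rw [mul_assoc]; exact mul_le_mul_of_nonneg_left hta2 hq0.le
  exact hS (q * x) q M₁ M₂ μ₁ μ₂ hy0 hy1 hq0 hq1 h10 h1M h11 hta1' h20 h2M h21 hta2'
    (fun j hj => hS1 q hq0 hqQ j hj) (fun j hj => hS2 q hq0 hqQ j hj) j' hj'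

/-- **`SingleGateConvClosed ⟹ GateMove`** (typer g26's one-layer form of leg (III)), through `SDECConvClosed`. [this work] -/
theorem gateMove_of_singleGate (hS : SingleGateConvClosed) : GateMove :=
  gateMove_of_sdecConvClosed (sdecConvClosed_of_singleGate hS)

/-- **`SingleGateConvClosed ⟹ TreeBuiltDEC`**: every tree-built count law is DEC at every layer (census-2 g53's structural induction). [this work] -/
theorem treeBuiltDEC_of_singleGate (hS : SingleGateConvClosed) : TreeBuiltDEC :=
  treeBuiltDEC_of_sdecConvClosed (sdecConvClosed_of_singleGate hS)

end LawDec

/-- **`SingleGateConvClosed ⟹ TreeDEC`** (Conjecture T-DEC, finite layers, gate coordinates). [this work] -/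
theorem treeDEC_of_singleGate (hS : LawDec.SingleGateConvClosed) : TreeDEC :=
  treeDEC_of_sdecConvClosed (LawDec.sdecConvClosed_of_singleGate hS)

/-- **`SingleGateConvClosed ⟹ Quant.FarTreeRow`** — the R8 tree row from the single-gate convolution closure alone. [this work] -/
theorem farTreeRow_of_singleGate (hS : LawDec.SingleGateConvClosed) : FarTreeRow :=
  farTreeRow_of_sdecConvClosed (LawDec.sdecConvClosed_of_singleGate hS)

end Quant

end Summit.CriticalPhenomena.PercolationContinuityZ3.Theorems
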